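import Summits.FinalStateConjecture.FinalStateConjecture.Theorems.ExactKerrEndsTameEscapeToKerrEndsKerrRestEnd
import Literature.Geometry.Lorentzian.KerrBoyerLindquistRigid
import Literature.Geometry.Lorentzian.CauchyDevelopmentComap
import Literature.Geometry.Lorentzian.ChartSecondFundamentalForm
import HarnessLib

/-!
# Route `ExactKerrEnds`, crux `TameEscapeToKerrEnds` (stmt-FinalStateConjecture-18522), line
# `matched-kerr-solution-map`: the rest-frame Kerr target with ARBITRARY SPIN AXIS AND CENTRE

Sequel of `ExactKerrEndsTameEscapeToKerrEndsKerrRestEnd.lean`. There the Boyer–Lindquist rest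
template `Kerr.BL.blData` (spin axis `y₃`, centre `0`) was shown to be chart-exact Kerr, DR-flat
with mass `M` and vacuum. An exterior gluing selects the Kerr member's spin axis and centre freely,
so the glued datum meets the template through a rigid motion `y ↦ g y + c` of the FIXED chart of
the end (`g : E3 ≃ₗᵢ[ℝ] E3`, `c : E3`): its chart components beyond some radius are
`hCoeff e D y = h_{g y + c}(g·, g·)`, `kCoeff e D y = k_{g y + c}(g·, g·)` with
`h = Kerr.Ingoing.blHRepCLM M a`, `k = Kerr.BL.kRepCLM M a`. This file records that such a datum is
still chart-exact Kerr (with leaf `Kerr.BL.leaf ∘ (y ↦ g y + c)` and normal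
`Kerr.BL.normal ∘ (y ↦ g y + c)`: reparametrisation naturality of the induced metric and of the
second fundamental form, `secondFundamentalForm_comp_right`), hence Kerr-ended on a sole end; the
companion Literature file `KerrBoyerLindquistRigid.lean` shows that the moved components are still
`(1 + 2M/r)δ + O₂(r⁻²)` with the SAME `M` and `O₂(r⁻³)` (so DR-flat with mass `M` in the fixed
chart) and jointly smooth in `(M, a, y)`.

* `chartKerrBLRigidBeyond_isChartExactKerrBeyond` — the unfolded `IsChartExactKerrBeyond e D ρ`
  from the moved chart identities beyond `ρ ≥ max ρ₁ 0 + ‖c‖`;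
* `hasExactKerrEnd_of_chartKerrBLRigidBeyond` — hence `D.HasExactKerrEnd` on a sole end.

References: Brandt–Seidel, Phys. Rev. D 54 (1996) 1403, §II; O'Neill 1983, Ch. 4, Lemma 4.4
(tensoriality of the shape operator); Corvino–Schoen, JDG 73 (2006), Thm. 4 (the 10-parameter Kerr
family of an exterior gluing: mass, spin VECTOR, centre, boost).
-/

set_option linter.dupNamespace false

noncomputable section

namespace Summit.FinalStateConjecture.FinalStateConjecture.Theorems.ExactKerrEnds

open scoped Manifold ContDiff InnerProductSpace
open Set Function TopologicalSpace Topology Bundle Literature.Geometry.Lorentzian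

variable {X : Type} [TopologicalSpace X] [ChartedSpace E3 X] [IsManifold (𝓡 3) ∞ X]

/-- Beyond `max ρ₁ 0 + ‖c‖ ≤ ρ < ‖y‖` the moved point `g y + c` lies in `Kerr.slice 0 ρ₁`.
[folklore] -/
theorem rigid_mem_kerrSlice_of_lt {ρ₁ ρ : ℝ} (g : E3 ≃ₗᵢ[ℝ] E3) (c : E3) (hρ : max ρ₁ 0 + ‖c‖ ≤ ρ)
    {y : E3} (hy : ρ < ‖y‖) : g y + c ∈ Kerr.slice 0 ρ₁ := by
  refine mem_kerrSlice_of_lt (ρ₁ := ρ₁) (ρ := max ρ₁ 0) le_rfl ?_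
  have h1 : ‖g y‖ - ‖c‖ ≤ ‖g y + c‖ := by
    have := norm_sub_le (g y + c) c
    rw [add_sub_cancel_right] at this
    linarith
  rw [g.norm_map] at h1
  linarith

/-- **Moved Boyer–Lindquist Kerr in the chart ⇒ chart-exact Kerr beyond `ρ`.** Let `e` be an end
of `X`, `D` a datum, `0 ≤ M`, `ρH(M, a) ≤ ρ₁`, `g` a linear isometry and `c` a vector of the chart
space with `max ρ₁ 0 + ‖c‖ ≤ ρ`. If for every `y` with `ρ < ‖y‖` the chart components of `D` are the
Boyer–Lindquist Kerr data read through the rigid motion `y ↦ g y + c`,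
`hCoeff e D y = h_{g y + c}(g·, g·)`, `kCoeff e D y = k_{g y + c}(g·, g·)`, then the unfolded
`IsChartExactKerrBeyond e D ρ` holds with parameters `(M, a, 0)`, leaf `Kerr.BL.leaf ∘ j` and
normal `Kerr.BL.normal ∘ j`, `j y = g y + c` (`d(leaf ∘ j) = d leaf ∘ g`; induced metric by the
chain rule, second fundamental form by `secondFundamentalForm_comp_right`). Brandt–Seidel 1996,
§II; O'Neill 1983, Ch. 4, Lemma 4.4; Corvino–Schoen 2006, Thm. 4.
[cite: CorvinoSchoen2006, §1 and Thm. 4] -/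
theorem chartKerrBLRigidBeyond_isChartExactKerrBeyond :
    ∀ {X : Type} [TopologicalSpace X] [ChartedSpace E3 X] [IsManifold (𝓡 3) ∞ X] [Kerr.Facts]
      (e : AFEnd X) (D : InitialDataSet (𝓡 3) X) {M a ρ₁ ρ : ℝ} (hM : 0 ≤ M)
      (hρ₁ : Kerr.BL.rhoH M a ≤ ρ₁) (g : E3 ≃ₗᵢ[ℝ] E3) (c : E3), max ρ₁ 0 + ‖c‖ ≤ ρ →
      (∀ y : E3, ρ < ‖y‖ → AFEnd.hCoeff e D y =
        (Kerr.Ingoing.blHRepCLM M a (g y + c)).bilinearComp (g : E3 →L[ℝ] E3) (g : E3 →L[ℝ] E3)) →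
      (∀ y : E3, ρ < ‖y‖ → AFEnd.kCoeff e D y =
        (Kerr.BL.kRepCLM M a (g y + c)).bilinearComp (g : E3 →L[ℝ] E3) (g : E3 →L[ℝ] E3)) →
      ∃ (M' a' r₀ : ℝ) (hM' : 0 ≤ M') (ψ : exteriorRegion ρ → Kerr.region a' r₀)
        (ν : NormalField 𝓘(ℝ, E4) ψ),
        Function.Injective ψ ∧
        (Kerr.smoothMetric M' a' r₀).IsSpacelikeImmersion 𝓘(ℝ, E3) ψ ∧
        (Kerr.smoothMetric M' a' r₀).IsFutureUnitNormal 𝓘(ℝ, E3)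
          ((Kerr.timeOrientation M' a' r₀ hM').ofLE le_top) ψ ν ∧
        (∀ (y : exteriorRegion ρ) (v w : E3),
          AFEnd.hCoeff e D (y : E3) v w =
            Kerr.bilin M' a' (ψ y : E4) (mfderiv 𝓘(ℝ, E3) 𝓘(ℝ, E4) ψ y v)
              (mfderiv 𝓘(ℝ, E3) 𝓘(ℝ, E4) ψ y w)) ∧
        (∀ [(Kerr.smoothMetric M' a' r₀).HasLeviCivita] (y : exteriorRegion ρ) (v w : E3),
          AFEnd.kCoeff e D (y : E3) v w =
            (Kerr.smoothMetric M' a' r₀).secondFundamentalForm 𝓘(ℝ, E3) ψ ν y v w) := by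
  intro X _ _ _ _ e D M a ρ₁ ρ hM hρ₁ g c hρ hh hk
  have hb : Kerr.BL.rH M a < Kerr.BL.rH M a + 1 := by linarith
  -- the rigid motion and its calculus
  set A : E3 → E3 := fun z ↦ g z + c with hA_def
  have hA : ContDiff ℝ ∞ A := (g : E3 →L[ℝ] E3).contDiff.add contDiff_const
  have hAd : ∀ z : E3, DifferentiableAt ℝ A z := fun z ↦
    ((g : E3 →L[ℝ] E3).differentiableAt).add (differentiableAt_const c)
  have hAf : ∀ z v : E3, fderiv ℝ A z v = g v := by
    intro z v
    have h1 : fderiv ℝ A z = (g : E3 →L[ℝ] E3) := by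
      rw [show A = fun z ↦ (g : E3 →L[ℝ] E3) z + c from rfl, fderiv_add_const,
        ContinuousLinearMap.fderiv]
    rw [h1]
    rfl
  set j : exteriorRegion ρ → Kerr.slice 0 ρ₁ :=
    fun y ↦ ⟨g y + c, rigid_mem_kerrSlice_of_lt g c hρ (mem_exteriorRegion.1 y.2)⟩ with hj_def
  have hj : ∀ y : exteriorRegion ρ, ((j y : Kerr.slice 0 ρ₁) : E3) = A y := fun _ ↦ rfl
  have hjd : ∀ y : exteriorRegion ρ, MDifferentiableAt 𝓘(ℝ, E3) 𝓘(ℝ, E3) j y := fun y ↦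
    OpensChart.mdifferentiableAt_of_repr hj (hAd _)
  have hjm : ∀ (y : exteriorRegion ρ) (v : E3), mfderiv 𝓘(ℝ, E3) 𝓘(ℝ, E3) j y v = g v := by
    intro y v
    rw [OpensChart.mfderiv_apply_of_repr hj (hAd _) v, hAf]
  have hjs : ContMDiff 𝓘(ℝ, E3) 𝓘(ℝ, E3) ∞ j := by
    intro y
    have h1 : ContMDiffAt 𝓘(ℝ, E3) 𝓘(ℝ, E3) ∞ (fun x : exteriorRegion ρ ↦ (j x : E3)) y :=
      (OpensChart.contMDiffAt_iff y _ A hj).2 hA.contDiffAt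
    exact (ChartedSpace.liftPropWithinAt_subtypeVal_comp_iff j Set.univ y).mp h1
  -- the leaf and its normal
  set L := Kerr.BL.leaf M a (Kerr.BL.rH M a + 1) ρ₁ hM hρ₁ with hL
  set N := Kerr.BL.normal M a (Kerr.BL.rH M a + 1) ρ₁ hM hρ₁ with hN
  have hLs := Kerr.BL.isSpacelikeImmersion_leaf (b := Kerr.BL.rH M a + 1) hM hρ₁ hb
  have hLn := Kerr.BL.isFutureUnitNormal_normal (b := Kerr.BL.rH M a + 1) hM hρ₁ hb
  have hd : ∀ y : exteriorRegion ρ, MDifferentiableAt 𝓘(ℝ, E3) 𝓘(ℝ, E4) L (j y) := fun y ↦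
    (Kerr.BL.contMDiff_leaf hM hρ₁ hb (j y)).mdifferentiableAt (by simp)
  have hmf : ∀ (y : exteriorRegion ρ) (v : E3),
      mfderiv 𝓘(ℝ, E3) 𝓘(ℝ, E4) (L ∘ j) y v = mfderiv 𝓘(ℝ, E3) 𝓘(ℝ, E4) L (j y) (g v) := by
    intro y v
    rw [mfderiv_comp y (hd y) (hjd y)]
    show mfderiv 𝓘(ℝ, E3) 𝓘(ℝ, E4) L (j y) (mfderiv 𝓘(ℝ, E3) 𝓘(ℝ, E3) j y v) = _
    rw [hjm y v]
  refine ⟨M, a, 0, hM, L ∘ j, fun y ↦ N (j y), ?_, ⟨?_, fun y v hv ↦ ?_⟩,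
    ⟨⟨fun y v ↦ ?_, fun y ↦ hLn.1.2 (j y)⟩, fun y ↦ hLn.2 (j y)⟩, fun y v w ↦ ?_, fun y v w ↦ ?_⟩
  · -- injective
    intro y₁ y₂ h
    have h' : j y₁ = j y₂ := Kerr.BL.leaf_injective hM hρ₁ h
    have h'' : g y₁ + c = g y₂ + c := congrArg (fun p : Kerr.slice 0 ρ₁ ↦ (p : E3)) h'
    exact Subtype.ext (g.injective (add_right_cancel h''))
  · -- smooth
    exact (Kerr.BL.contMDiff_leaf hM hρ₁ hb).comp hjs
  · -- spacelike
    have hv' : (g v : E3) ≠ 0 := fun h0 ↦ hv (g.injective (h0.trans (map_zero g).symm))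
    have h := hLs.inducedBilin_pos (j y) hv'
    rw [PseudoRiemannianMetric.inducedBilin_apply, Kerr.smoothMetric_val] at h ⊢
    rw [hmf y v]
    exact h
  · -- normal
    rw [hmf y]
    exact hLn.1.1 (j y) (g v)
  · -- the metric clause
    rw [hh y y.2, hmf y, hmf y, Function.comp_apply,
      Kerr.BL.bilin_mfderiv_leaf hM hρ₁ hb (j y) (g v) (g w),
      ContinuousLinearMap.bilinearComp_apply, Kerr.Ingoing.blHRepCLM_apply]
    rfl
  · -- the `k` clause
    have hν : MDifferentiableAt 𝓘(ℝ, E3) 𝓘(ℝ, E4).tangent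
        (fun x ↦ (TotalSpace.mk' E4 (L x) (N x) : TangentBundle 𝓘(ℝ, E4) (Kerr.region a 0)))
        (j y) :=
      (Kerr.BL.contMDiff_normalLift hM hρ₁ hb (j y)).mdifferentiableAt (by simp)
    have hK := (Kerr.smoothMetric M a 0).toPseudoRiemannianMetric.secondFundamentalForm_comp_right
      (f := L) (ν := N) (Ψ := j) (u := y) BoundarylessManifold.isInteriorPoint
      BoundarylessManifold.isInteriorPoint hν (hjd y) v w
    rw [hjm y v, hjm y w] at hK
    rw [hk y y.2, ContinuousLinearMap.bilinearComp_apply, hK]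
    exact (Kerr.BL.secondFundamentalForm_leaf hM hρ₁ hb (j y) (g v) (g w)).symm

/-- **A datum which is moved Boyer–Lindquist Kerr in the chart of a sole end is Kerr-ended.** On a
sole asymptotically flat end `e` of `X` with `e.R ≤ ρ`, `max ρ₁ 0 + ‖c‖ ≤ ρ`, `ρH ≤ ρ₁`, `0 ≤ M`:
if beyond `ρ` the chart components of `D` are the Boyer–Lindquist Kerr data read through the rigid
motion `y ↦ g y + c`, then `D.HasExactKerrEnd` (via the landed stub S3a `chartKerrEnd`).
Corvino–Schoen 2006, Thm. 4; Brandt–Seidel 1996, §II. [cite: CorvinoSchoen2006, §1 and Thm. 4] -/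
theorem hasExactKerrEnd_of_chartKerrBLRigidBeyond [T2Space X] [SecondCountableTopology X]
    [ConnectedSpace X] (e : AFEnd X) (D : InitialDataSet (𝓡 3) X) {M a ρ₁ ρ : ℝ} (hM : 0 ≤ M)
    (hρ₁ : Kerr.BL.rhoH M a ≤ ρ₁) (g : E3 ≃ₗᵢ[ℝ] E3) (c : E3) (hρ : max ρ₁ 0 + ‖c‖ ≤ ρ)
    (hsole : e.IsSoleEnd) (hRρ : e.R ≤ ρ)
    (hh : ∀ y : E3, ρ < ‖y‖ → AFEnd.hCoeff e D y =
      (Kerr.Ingoing.blHRepCLM M a (g y + c)).bilinearComp (g : E3 →L[ℝ] E3) (g : E3 →L[ℝ] E3))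
    (hk : ∀ y : E3, ρ < ‖y‖ → AFEnd.kCoeff e D y =
      (Kerr.BL.kRepCLM M a (g y + c)).bilinearComp (g : E3 →L[ℝ] E3) (g : E3 →L[ℝ] E3)) :
    D.HasExactKerrEnd := by
  intro hKF
  exact chartKerrEnd X e D ρ hsole hRρ
    (chartKerrBLRigidBeyond_isChartExactKerrBeyond e D hM hρ₁ g c hρ hh hk)

end Summit.FinalStateConjecture.FinalStateConjecture.Theorems.ExactKerrEnds

end
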